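import Summits.MatrixMultiplication.OmegaCensus.STPPVosperSlackTwoCheckersT
import Summits.MatrixMultiplication.OmegaCensus.STPPVosperSlackTwoTablesZ53
import Summits.MatrixMultiplication.OmegaCensus.STPPVosperSlackTwoLawABQ
import Summits.MatrixMultiplication.OmegaCensus.STPPVosperSlackTwoRows61CM11

/-!
# ω-census (abelian STPP census): ℤ₅₃ leaf {(2,3,3)³} — case B′ rows, part 2 of 2: the interval shape `Q = [0, 3]` by branches (kernel computations)

HONEST FRAMING (pub-omega census; verbatim): lottery ticket; floor = certified bounds/negative ranges.
Census STRUCTURE (seat pub-omega-stpp-2 gen 31, 2026-08-29), family (b2).  The one case-B′ shape whose single `decide` exceeds the kernel budget: `Q = [0, 3]`, pattern `P + Q = [0, 6)` (an interval),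
`caseADeadT 53 3 3 12 18 [0, 3] tblZ53B`.  Its tiling loop (`tilesAll`, three translates outside `SY = [0, 14)`; live first translates `19 ≤ j ≤ 52`) reaches
four table leaves with `#Zc = 18 = z` — at `(19,25,31)`, `(19,25,52)`, `(19,46,52)`, `(40,46,52)` (python mirror, HOME `pub-omega-stpp-2-g31/code/s2/`) — and each such
leaf evaluates `(members … zc).sublistsLen 18` on an 18-element list, ≈ 2¹⁸ kernel steps.  So the loop is PEELED branch by branch with stpp-2 g27's
`tilesAll_transMasks_drop` (`STPPVosperSlackTwoRows61CM11.lean`): every `decide +kernel` below contains at most one heavy leaf.  No new mathematics; the chunk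
theorem `rows53B_c3` (index `49` of `qShapes 53 2`) is the form the assembly consumes.  Nothing here is progress on `ω`.
-/

namespace Summit.MatrixMultiplication.OmegaCensus.CubeNB.S2

open Summit.MatrixMultiplication.OmegaCensus.CubeNB.Bits

/-- `cond c X true = true` once `X = true`. [folklore] -/
theorem cond_true_right_of_eq_true {c X : Bool} (h : X = true) : cond c X true = true := by
  cases c <;> simp [h]

/-- `(a || X) = true` once `X = true`. [folklore] -/
theorem or_eq_true_right_of_eq_true {a X : Bool} (h : X = true) : (a || X) = true := by
  simp [h]

/-- Third level under translates `19, 25`: branches `j ≥ 32` (one heavy leaf at `52`), one `decide`. [folklore] -/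
theorem rows53B_q03_v32 : tilesAll (caseALeafT 53 3 12 18 [0, 3] tblZ53B) 1 ((transMasks 53 (pattPQ 53 (List.range 3) [0, 3])).drop 32) (([] ++ [19]) ++ [25]) (((maskOf (List.range (3 + 12 - 1))) ||| (maskOf ((pattPQ 53 (List.range 3) [0, 3]).map fun y => (19 + 53 - y) % 53))) ||| (maskOf ((pattPQ 53 (List.range 3) [0, 3]).map fun y => (25 + 53 - y) % 53))) = true := by
  decide +kernel

/-- Third level under `19, 25`: branches `j ≥ 31` (the heavy leaf `31` peeled). [folklore] -/
theorem rows53B_q03_v31 : tilesAll (caseALeafT 53 3 12 18 [0, 3] tblZ53B) 1 ((transMasks 53 (pattPQ 53 (List.range 3) [0, 3])).drop 31) (([] ++ [19]) ++ [25]) (((maskOf (List.range (3 + 12 - 1))) ||| (maskOf ((pattPQ 53 (List.range 3) [0, 3]).map fun y => (19 + 53 - y) % 53))) ||| (maskOf ((pattPQ 53 (List.range 3) [0, 3]).map fun y => (25 + 53 - y) % 53))) = true := by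
  rw [tilesAll_transMasks_drop _ 53 _ 0 (show 31 < 53 by decide), Bool.and_eq_true]
  refine ⟨by decide +kernel, ?_⟩
  exact rows53B_q03_v32

/-- Third level under `19, 25`: branches `j ≥ 26` (light branches `26 … 30` peeled). [folklore] -/
theorem rows53B_q03_v26 : tilesAll (caseALeafT 53 3 12 18 [0, 3] tblZ53B) 1 ((transMasks 53 (pattPQ 53 (List.range 3) [0, 3])).drop 26) (([] ++ [19]) ++ [25]) (((maskOf (List.range (3 + 12 - 1))) ||| (maskOf ((pattPQ 53 (List.range 3) [0, 3]).map fun y => (19 + 53 - y) % 53))) ||| (maskOf ((pattPQ 53 (List.range 3) [0, 3]).map fun y => (25 + 53 - y) % 53))) = true := by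
  rw [tilesAll_transMasks_drop _ 53 _ 0 (show 26 < 53 by decide), Bool.and_eq_true]
  refine ⟨by decide +kernel, ?_⟩
  rw [tilesAll_transMasks_drop _ 53 _ 0 (show 27 < 53 by decide), Bool.and_eq_true]
  refine ⟨by decide +kernel, ?_⟩
  rw [tilesAll_transMasks_drop _ 53 _ 0 (show 28 < 53 by decide), Bool.and_eq_true]
  refine ⟨by decide +kernel, ?_⟩
  rw [tilesAll_transMasks_drop _ 53 _ 0 (show 29 < 53 by decide), Bool.and_eq_true]
  refine ⟨by decide +kernel, ?_⟩
  rw [tilesAll_transMasks_drop _ 53 _ 0 (show 30 < 53 by decide), Bool.and_eq_true]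
  refine ⟨by decide +kernel, ?_⟩
  exact rows53B_q03_v31

/-- Second level under translate `19`: branches `j ≥ 26` (one heavy leaf at `(46,52)`), one `decide`. [folklore] -/
theorem rows53B_q03_u26 : tilesAll (caseALeafT 53 3 12 18 [0, 3] tblZ53B) 2 ((transMasks 53 (pattPQ 53 (List.range 3) [0, 3])).drop 26) ([] ++ [19]) ((maskOf (List.range (3 + 12 - 1))) ||| (maskOf ((pattPQ 53 (List.range 3) [0, 3]).map fun y => (19 + 53 - y) % 53))) = true := by
  decide +kernel

/-- Second level under `19`: branches `j ≥ 25` (branch `25` = the third-level theorem). [folklore] -/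
theorem rows53B_q03_u25 : tilesAll (caseALeafT 53 3 12 18 [0, 3] tblZ53B) 2 ((transMasks 53 (pattPQ 53 (List.range 3) [0, 3])).drop 25) ([] ++ [19]) ((maskOf (List.range (3 + 12 - 1))) ||| (maskOf ((pattPQ 53 (List.range 3) [0, 3]).map fun y => (19 + 53 - y) % 53))) = true := by
  rw [tilesAll_transMasks_drop _ 53 _ 1 (show 25 < 53 by decide), Bool.and_eq_true]
  exact ⟨cond_true_right_of_eq_true rows53B_q03_v26, rows53B_q03_u26⟩

/-- Second level under `19`: branches `j ≥ 20` (light branches `20 … 24` peeled). [folklore] -/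
theorem rows53B_q03_u20 : tilesAll (caseALeafT 53 3 12 18 [0, 3] tblZ53B) 2 ((transMasks 53 (pattPQ 53 (List.range 3) [0, 3])).drop 20) ([] ++ [19]) ((maskOf (List.range (3 + 12 - 1))) ||| (maskOf ((pattPQ 53 (List.range 3) [0, 3]).map fun y => (19 + 53 - y) % 53))) = true := by
  rw [tilesAll_transMasks_drop _ 53 _ 1 (show 20 < 53 by decide), Bool.and_eq_true]
  refine ⟨by decide +kernel, ?_⟩
  rw [tilesAll_transMasks_drop _ 53 _ 1 (show 21 < 53 by decide), Bool.and_eq_true]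
  refine ⟨by decide +kernel, ?_⟩
  rw [tilesAll_transMasks_drop _ 53 _ 1 (show 22 < 53 by decide), Bool.and_eq_true]
  refine ⟨by decide +kernel, ?_⟩
  rw [tilesAll_transMasks_drop _ 53 _ 1 (show 23 < 53 by decide), Bool.and_eq_true]
  refine ⟨by decide +kernel, ?_⟩
  rw [tilesAll_transMasks_drop _ 53 _ 1 (show 24 < 53 by decide), Bool.and_eq_true]
  refine ⟨by decide +kernel, ?_⟩
  exact rows53B_q03_u25

/-- First level: branches `j ≥ 20` (one heavy leaf at `(40,46,52)`), one `decide`. [folklore] -/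
theorem rows53B_q03_t20 : tilesAll (caseALeafT 53 3 12 18 [0, 3] tblZ53B) 3 ((transMasks 53 (pattPQ 53 (List.range 3) [0, 3])).drop 20) [] (maskOf (List.range (3 + 12 - 1))) = true := by
  decide +kernel

/-- First level: branches `j ≥ 19` (branch `19` = the second-level theorem). [folklore] -/
theorem rows53B_q03_t19 : tilesAll (caseALeafT 53 3 12 18 [0, 3] tblZ53B) 3 ((transMasks 53 (pattPQ 53 (List.range 3) [0, 3])).drop 19) [] (maskOf (List.range (3 + 12 - 1))) = true := by
  rw [tilesAll_transMasks_drop _ 53 _ 2 (show 19 < 53 by decide), Bool.and_eq_true]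
  exact ⟨cond_true_right_of_eq_true rows53B_q03_u20, rows53B_q03_t20⟩

/-- First level, all branches (the translates `0 … 18` meet `SY` and are dead). [folklore] -/
theorem rows53B_q03_t0 : tilesAll (caseALeafT 53 3 12 18 [0, 3] tblZ53B) 3 ((transMasks 53 (pattPQ 53 (List.range 3) [0, 3])).drop 0) [] (maskOf (List.range (3 + 12 - 1))) = true := by
  rw [tilesAll_transMasks_drop _ 53 _ 2 (show 0 < 53 by decide), Bool.and_eq_true]
  refine ⟨by decide +kernel, ?_⟩
  rw [tilesAll_transMasks_drop _ 53 _ 2 (show 1 < 53 by decide), Bool.and_eq_true]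
  refine ⟨by decide +kernel, ?_⟩
  rw [tilesAll_transMasks_drop _ 53 _ 2 (show 2 < 53 by decide), Bool.and_eq_true]
  refine ⟨by decide +kernel, ?_⟩
  rw [tilesAll_transMasks_drop _ 53 _ 2 (show 3 < 53 by decide), Bool.and_eq_true]
  refine ⟨by decide +kernel, ?_⟩
  rw [tilesAll_transMasks_drop _ 53 _ 2 (show 4 < 53 by decide), Bool.and_eq_true]
  refine ⟨by decide +kernel, ?_⟩
  rw [tilesAll_transMasks_drop _ 53 _ 2 (show 5 < 53 by decide), Bool.and_eq_true]
  refine ⟨by decide +kernel, ?_⟩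
  rw [tilesAll_transMasks_drop _ 53 _ 2 (show 6 < 53 by decide), Bool.and_eq_true]
  refine ⟨by decide +kernel, ?_⟩
  rw [tilesAll_transMasks_drop _ 53 _ 2 (show 7 < 53 by decide), Bool.and_eq_true]
  refine ⟨by decide +kernel, ?_⟩
  rw [tilesAll_transMasks_drop _ 53 _ 2 (show 8 < 53 by decide), Bool.and_eq_true]
  refine ⟨by decide +kernel, ?_⟩
  rw [tilesAll_transMasks_drop _ 53 _ 2 (show 9 < 53 by decide), Bool.and_eq_true]
  refine ⟨by decide +kernel, ?_⟩
  rw [tilesAll_transMasks_drop _ 53 _ 2 (show 10 < 53 by decide), Bool.and_eq_true]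
  refine ⟨by decide +kernel, ?_⟩
  rw [tilesAll_transMasks_drop _ 53 _ 2 (show 11 < 53 by decide), Bool.and_eq_true]
  refine ⟨by decide +kernel, ?_⟩
  rw [tilesAll_transMasks_drop _ 53 _ 2 (show 12 < 53 by decide), Bool.and_eq_true]
  refine ⟨by decide +kernel, ?_⟩
  rw [tilesAll_transMasks_drop _ 53 _ 2 (show 13 < 53 by decide), Bool.and_eq_true]
  refine ⟨by decide +kernel, ?_⟩
  rw [tilesAll_transMasks_drop _ 53 _ 2 (show 14 < 53 by decide), Bool.and_eq_true]
  refine ⟨by decide +kernel, ?_⟩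
  rw [tilesAll_transMasks_drop _ 53 _ 2 (show 15 < 53 by decide), Bool.and_eq_true]
  refine ⟨by decide +kernel, ?_⟩
  rw [tilesAll_transMasks_drop _ 53 _ 2 (show 16 < 53 by decide), Bool.and_eq_true]
  refine ⟨by decide +kernel, ?_⟩
  rw [tilesAll_transMasks_drop _ 53 _ 2 (show 17 < 53 by decide), Bool.and_eq_true]
  refine ⟨by decide +kernel, ?_⟩
  rw [tilesAll_transMasks_drop _ 53 _ 2 (show 18 < 53 by decide), Bool.and_eq_true]
  refine ⟨by decide +kernel, ?_⟩
  exact rows53B_q03_t19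

/-- **The interval shape is dead**: `caseADeadT 53 3 3 12 18 [0, 3] tblZ53B = true`. [cite: CohnKleinbergSzegedyUmans2005, Def. 5.1] -/
theorem rows53B_q03 : caseADeadT 53 3 3 12 18 [0, 3] tblZ53B = true := by
  unfold caseADeadT
  exact or_eq_true_right_of_eq_true (by simpa only [List.drop_zero] using rows53B_q03_t0)

/-- Rows chunk `[49, 50)` (= the shape `[0, 3]`) in the form the assembly consumes. [folklore] -/
theorem rows53B_c3 : ((qShapes 53 2 49 50).all fun Q => dihedralSmaller 53 Q || caseADeadT 53 3 3 12 18 Q tblZ53B) = true := by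
  rw [show qShapes 53 2 49 50 = [[0, 3]] from by decide]
  simp only [List.all_cons, List.all_nil, Bool.and_true, Bool.or_eq_true]
  exact Or.inr rows53B_q03

end Summit.MatrixMultiplication.OmegaCensus.CubeNB.S2
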